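/-
Copyright (c) 2026 the pub-hodgecm-mathlib formalisation cell (harness21).  Prover seat hodgecm-mathlib-K2E5-p16 (g9) (S10 dealer R90-C138-plan (g3) RE-DEAL #61′, RULING J-LC′ ∕ J-LC′-2,
conductor R90-C138-p06 (g0), 2026-09-05): R90-TF · S10 (Rogawski 1990 §13.8) · THE RESIDUAL LETTER L-C′ `TorusCharExtendLetter L v` HOLDS.
-/
import Summits.HodgeConjecture.HodgeConjecture.Theorems.R90S10TorusCharExtend              -- ★ FILE 1 (this seat): `exists_isAutomorphic_torusLocalComponent_eq_spherical_off_of_exponents`, `unitsMap_adeleToLocal_mem_normOneUnits`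
import Summits.HodgeConjecture.HodgeConjecture.Theorems.R90S10TorsionCharCompensation     -- ★ B3 (R90-C138-p06): `exists_archExponents_compensating`
import Summits.HodgeConjecture.HodgeConjecture.Theorems.R90S10TorusCharExtendLetterDefs    -- ★ the letter (R90-C138-p06): `TorusCharExtendLetter`
import HarnessLib

/-!
# R90-TF · S10 (Rogawski 1990 §13.8) · THEOREMS — `torusCharExtendLetter_holds : TorusCharExtendLetter L v` (the residual letter L-C′ of `sock_S10_realiseH₂`, PAID)

Cell hodgecm-mathlib, slab R90-TF, section S10 = §13.8, crux item h413 = `stmt-HodgeConjecture-24833` (route `route-HodgeConjecture-HCCMUnconditional`).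
Prover seat K2E5-p16 (g9); RE-DEAL #61′ (RULINGS J-LC′, J-LC′-2).  THEOREMS ONLY (no `def`, no `instance`, no `notation`, no named-fact hypothesis, no `sorry`);
lane `--supports stmt-HodgeConjecture-24833 --as helper`.

THE LETTER (★ `R90S10TorusCharExtendLetterDefs`, R90-C138-p06): at a finite place `v` of `L⁺` NOT split in `L`, every continuous character `χ_T` of the compact local torus
`T(L⁺_v)` is the `v`-component of an AUTOMORPHIC character `ψ` of `T(𝔸_{L⁺})` which is trivial on `T(𝒪_w)` at EVERY finite `w ≠ v` and whose base change has a unitary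
archimedean type `(2e, 0)` — [Rogawski1990, §13.8 p. 217 l. 9–12] « every character of `∏′ 𝒪_v^1` extends to a character of `E^1 \ E^1_𝔸` … with `φ_w = φ′` ».

THE PROOF = ★ FILE 1 `exists_isAutomorphic_torusLocalComponent_eq_spherical_off_of_exponents` (Weil's principle with prescribed components, Lit. `TorusLocalDatum` §45.16, data
`1` on the ramified places) fed with COMPENSATING EXPONENTS: the torsion character `ζ ↦ χ_T((ζ)_v)` of `μ(L) = CommGroup.torsion Lˣ` (roots of unity lie in the torus, ★
`TorusDict.principalIdele_mem_torus_of_pow_eq_one`; their `v`-block is norm-one, ★ FILE 1 `unitsMap_adeleToLocal_mem_normOneUnits`) is extended to a character of `Lˣ` by the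
divisibility of `ℂˣ` (★ `Subgroup.exists_monoidHom_extension_eq_one`, `IsAlgClosed.exists_pow_nat_eq`), and ★ B3 `exists_archExponents_compensating` (R90-C138-p06) gives `e` with
`χ_T((ζ)_v) · ∏_w ι_w(ζ)^{-e_w} = 1`, i.e. FILE 1's binder `hζ`.

* `exists_pow_eq_units_complex` — `ℂˣ` is divisible;
* `exists_monoidHom_extending_torusChar_on_torsion` — a character `χ : Lˣ →* ℂˣ` with `χ ζ = χ_T((ζ)_v)` on the roots of unity;
* **`torusCharExtendLetter_holds (L) (v) : TorusCharExtendLetter L v`**.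

HONEST LABEL: this pays the residual letter L-C′ (`sock_S10_torusCharExtend` of A ED. 10 reads `TorusCharExtendLetter L v` BY NAME); it pays no S10 socket by itself until the Lines
edition names it; HC_CM is proved only modulo the 7 printed citations (2 remaining named inputs: hLiu418 = `stmt-HodgeConjecture-24832`, h413 = `stmt-HodgeConjecture-24833`) until
rung 0 closes; count-neutral helper; REL ≠ ★ ≠ BUILT.  Namespace `Summit.HodgeConjecture.HodgeConjecture.R90.S10`.

## References
* [Rogawski1990] J. D. Rogawski, *Automorphic Representations of Unitary Groups in Three Variables*, Ann. of Math. Stud. 123 (1990): §13.8 p. 217 l. 9–12.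
* [Arthur2013] J. Arthur, *The Endoscopic Classification of Representations*, AMS Colloquium Publ. 61 (2013): §6.2, Lemma 6.2.2 and Remarks 2–3.
* [Weil1956] A. Weil, *On a certain type of characters of the idèle-class group of an algebraic number-field*, Tokyo–Nikko 1955 (1956) (the extension principle).
-/

set_option autoImplicit false
-- the mandated namespace repeats the single-problem summit's segment (`HodgeConjecture.HodgeConjecture`)
set_option linter.dupNamespace false

noncomputable section

open NumberField IsDedekindDomain
open Literature.NumberTheory Literature.NumberTheory.Automorphic Literature.NumberTheory.Automorphic.UnitaryGroup
open Literature.NumberTheory.GaloisRepresentations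
open Literature.NumberTheory.Automorphic.Arthur2013.Leaves.TECR

namespace Summit.HodgeConjecture.HodgeConjecture.R90.S10

/-- **`ℂˣ` is divisible**: every unit has an `n`-th root for `n > 0` (`ℂ` algebraically closed). [folklore] -/
theorem exists_pow_eq_units_complex (n : ℕ) (hn : 0 < n) (c : ℂˣ) : ∃ d : ℂˣ, d ^ n = c := by
  obtain ⟨z, hz⟩ := IsAlgClosed.exists_pow_nat_eq (c : ℂ) hn
  have hz0 : z ≠ 0 := fun h => by
    rw [h, zero_pow hn.ne'] at hz
    exact Units.ne_zero c hz.symm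
  exact ⟨Units.mk0 z hz0, Units.ext (by rw [Units.val_pow_eq_pow_val, Units.val_mk0, hz])⟩

variable (L : Type) [Field L] [NumberField L] [IsCMField L]

/-- **the torsion character `ζ ↦ χ_T((ζ)_v)` extends to `Lˣ`.**  For a character `χ_T` of the local norm-one torus at `v` there is `χ : Lˣ →* ℂˣ` with
`χ ζ = χ_T((ζ)_v)` for every root of unity `ζ` (`(ζ)` lies in the torus, ★ `TorusDict.principalIdele_mem_torus_of_pow_eq_one`, so its `v`-block is norm-one, ★
`unitsMap_adeleToLocal_mem_normOneUnits`; extension from `CommGroup.torsion Lˣ` by the divisibility of `ℂˣ`, ★ `Subgroup.exists_monoidHom_extension_eq_one`).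
[cite: Weil1956, §1] [cite: Arthur2013, §6.2 Remark 2] -/
theorem exists_monoidHom_extending_torusChar_on_torsion (v : HeightOneSpectrum (𝓞 ↥(maximalRealSubfield L)))
    (χT : ↥(normOneUnits (conjLocal L (IsCMField.complexConj L) v)) →* ℂˣ) :
    ∃ χ : Lˣ →* ℂˣ, ∀ (ζ : Lˣ) (hζT : Units.map (adeleToLocal L v : AdeleRing (𝓞 L) L →+* LocalRing L v).toMonoidHom (GaloisRepresentations.principalIdele L ζ) ∈
        normOneUnits (conjLocal L (IsCMField.complexConj L) v)), IsOfFinOrder ζ → χ ζ = χT ⟨_, hζT⟩ := by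
  -- the roots of unity lie in the torus, so their `v`-blocks are norm-one
  have hmemT : ∀ k : Lˣ, IsOfFinOrder k → GaloisRepresentations.principalIdele L k ∈ TorusDict.torus (IsCMField.complexConj L) := fun k hk => by
    obtain ⟨n, hn, hkn⟩ := isOfFinOrder_iff_pow_eq_one.mp hk
    exact TorusDict.principalIdele_mem_torus_of_pow_eq_one (IsCMField.complexConj L) (Algebra.IsQuadraticExtension.finrank_eq_two ↥(maximalRealSubfield L) L)
      (IsCMField.complexConj_ne_one (K := L)) inferInstance inferInstance hn.ne' hkn
  have hmemN : ∀ k : ↥(CommGroup.torsion Lˣ), Units.map (adeleToLocal L v : AdeleRing (𝓞 L) L →+* LocalRing L v).toMonoidHom (GaloisRepresentations.principalIdele L (k : Lˣ)) ∈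
      normOneUnits (conjLocal L (IsCMField.complexConj L) v) :=
    fun k => unitsMap_adeleToLocal_mem_normOneUnits L (hmemT k ((CommGroup.mem_torsion (k : Lˣ)).1 k.2))
  -- the torsion character `χ₀ := χ_T ∘ (·)_v ∘ ( · ) ∘ incl`
  let φ : ↥(CommGroup.torsion Lˣ) →* ↥(normOneUnits (conjLocal L (IsCMField.complexConj L) v)) :=
    MonoidHom.codRestrict
      ((Units.map (adeleToLocal L v : AdeleRing (𝓞 L) L →+* LocalRing L v).toMonoidHom).comp
        ((GaloisRepresentations.principalIdele L).comp (CommGroup.torsion Lˣ).subtype))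
      _ hmemN
  have hφ : ∀ k : ↥(CommGroup.torsion Lˣ), φ k = ⟨_, hmemN k⟩ := fun k => rfl
  obtain ⟨χ, -, hχ⟩ := Subgroup.exists_monoidHom_extension_eq_one exists_pow_eq_units_complex (⊥ : Subgroup Lˣ) (CommGroup.torsion Lˣ) (χT.comp φ)
    (fun w hw => by
      have h1 : w = 1 := Subtype.ext ((Subgroup.mem_bot).1 hw)
      rw [h1, map_one])
  refine ⟨χ, fun ζ hζT hfin => ?_⟩
  have hk : ζ ∈ CommGroup.torsion Lˣ := (CommGroup.mem_torsion ζ).2 hfin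
  have h := hχ ⟨ζ, hk⟩
  rw [MonoidHom.comp_apply, hφ] at h
  exact h

/-- **THE RESIDUAL LETTER L-C′ HOLDS: `TorusCharExtendLetter L v`.**  At a finite place `v` of `L⁺` not split in `L`, every continuous character of `T(L⁺_v)` is the `v`-component of an
automorphic character of `T(𝔸_{L⁺})` that is trivial on `T(𝒪_w)` for EVERY finite `w ≠ v` and whose base change has a unitary archimedean type `(2e, 0)` — ★ FILE 1 at the
COMPENSATING exponents of ★ B3 `exists_archExponents_compensating` applied to the extended torsion character `ζ ↦ χ_T((ζ)_v)`.
[cite: Rogawski1990, §13.8 p. 217 l. 9–12] [cite: Arthur2013, §6.2 Lemma 6.2.2 and Remarks 2–3] [cite: Weil1956, §1] -/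
theorem torusCharExtendLetter_holds (v : HeightOneSpectrum (𝓞 ↥(maximalRealSubfield L))) : TorusCharExtendLetter L v := by
  unfold TorusCharExtendLetter
  intro hns χT hχTc
  obtain ⟨χ, hχ⟩ := exists_monoidHom_extending_torusChar_on_torsion L v χT
  obtain ⟨w₀⟩ := (inferInstance : Nonempty (InfinitePlace L))
  obtain ⟨e, he⟩ := exists_archExponents_compensating w₀ χ
  obtain ⟨ψ, hψ, hloc, hsph, harch⟩ := exists_isAutomorphic_torusLocalComponent_eq_spherical_off_of_exponents L v hns χT hχTc e
    (fun ζ hζT hfin => by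
      rw [← hχ ζ hζT hfin, eq_inv_of_mul_eq_one_left (he ζ hfin), ← Finset.prod_inv_distrib]
      exact Finset.prod_congr rfl fun w _ => by rw [zpow_neg, inv_inv])
  exact ⟨ψ, hψ, e, hloc, hsph, harch⟩

end Summit.HodgeConjecture.HodgeConjecture.R90.S10

end
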